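import Summits.QuantumFields.BalabanUV.T4Continuum.Support.ShellMeasurePinnedNorm
import Summits.QuantumFields.BalabanUV.T4Continuum.Support.ShellMeasureLandauDerivativeDecayTorus

/-!
# `T4Continuum.ShellMeasureLandauDerivativeDecayPinned` — row S67 companion to the LOCALITY ROAD (row S70 «END-II-loc:
# the LD chain in two norms», holder leaf-01-g6; invited split «the `DCf`∕`D` pinned bound over S67»): a map `D` on
# bond fields whose derivative kernel has (73)-TYPE decay is LIPSCHITZ IN THE PINNED NORM of S69, with the pinned
# operator bound `κ·M_{δ−δ′}`; instance: the Landau correction of S67 f3 on the torus (cell `pub-balaban`, sub-cell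
# `t4`, spine estimate NE7c (node U5b); NE7c ROUND-2 crew, unit `b2b-balaban-t4-ne7c-formalise-leaf-08` gen 12, owner
# table `LEAVES-NE7c-P1.md` rows S67∕S70; imports the owner's S69 `ShellMeasurePinnedNorm` (p223286) and my S67 f3
# `ShellMeasureLandauDerivativeDecayTorus` (p223512) ONLY; [folklore]; 0 def, 0 `def … : Prop`, 0 sorry)

HONEST FRAMING.  Finite four-torus programme, rung (B)+1 only — NOT infinite volume, NOT a mass gap, NOT the Clay
problem, NOT summit progress; (B), `BetaPertHyp`, (B^μ) are not consumed.  NE7c (`T4IndicatorShell.ShellWeightBound`)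
is NOT PRINTED and NOT PROVED; «NE7c ⇐ the named binders» (WALL `t4/b2b-balaban-t4-ne7c-p1/WALL-NE7c-P1.md` §2).
Functional-analytic plumbing on OUR side (chain rule through S65's identity `toPiL`, the mean-value inequality on a
convex set); nothing printed is asserted.  [Balaban1985Variational] (73) p. 289 is the LOCATOR for the SHAPE of the
decay hypothesis; (46) (= [5] Thm 3.12, the deep wall), (44)∕(55), B7 (89) locate the inputs of the instance.  HONEST
DEPENDENCY (cell): continuum YM on T⁴ ⇐ BetaPertH ∧ nine spine estimates (0/9 proved); BetaPertH ⇐ (D1) ∧ (D4) ∧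
CAP+tail; G-an2-4 gates asym, D1 and NE2/3/4.

THE POINT (owner finding F-ne7cp1-g30-1 and row S70 (ii)∕(iv)).  END-II of record reads the exponent field's variation
in the flat sup norm, which is locality-blind; the locality road re-reads it in S69's PINNED norm
`WSup (pinW δ′ ϖ) 1` (`‖A‖_pin = sup_b e^{δ′ϖ(b)}‖A b‖`, `ϖ` = distance to the block).  For the LINEAR letters (`H`,
`H₁`, `𝒢`) S69 (A) `opNorm_kerOpPin_le` turns a displayed kernel decay into a pinned operator bound.  THIS FILE does the
same for a NONLINEAR letter — any `D` differentiable on the flat ball whose derivative KERNEL `entry (DD(A))` (S67 f1)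
decays — and instantiates it with the Landau correction of S67 f3:
* §1 `hasFDerivAt_pinned`: `D` read in pinned coordinates, `Y ↦ toPiL⁻¹(D(toPiL Y))`, has derivative
  `kerOpPin (entry (DD(toPiL Y))) δ′ (ϖ∘pos) (ϖ∘pos)` (S69's conjugated kernel operator; `kerOp (entry T) = T`);
  `convex_preimage_ball` (the flat ball is convex in pinned coordinates).
* §2 **`norm_sub_pin_le_of_entry_decay`** — THE PINNED MEAN-VALUE BOUND: if `‖entry (DD(A)) c b‖ ≤ κ·e^{−δρ(pos c,
  pos b)}` for every `A` in the flat ball `ball 0 r`, the pin is one-sided Lipschitz (`ϖ x ≤ ϖ y + ρ x y`), `0 ≤ δ′`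
  and the reduced-rate sums obey `Σ_b e^{−(δ−δ′)ρ(x, pos b)} ≤ M`, then for all `A, A′` in the flat ball
  `‖D A − D A′‖_pin ≤ κ·M·‖A − A′‖_pin`; `norm_pin_le_of_entry_decay`: the VARIATION `‖D A − D 0‖_pin ≤ κ·M·‖A‖_pin`.
* §3 **`norm_sub_pin_le_torus`** — THE INSTANCE: on `(ℤ∕Tℤ)ᵈ` with `ρ = pl1`, the torus pin `ϖ = pinDist B₀` (S69
  `pinDist_le_add`), `M = m·K₁ d (δ − δ′)` (S66 f3a), and the Landau correction `D` of S67 f3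
  (`entry_fderiv_decay_torus`: `κ = 16C₂m₀e^{δr₀}·r` from END-II's∕S64's pair (hCq, hCd), LOCALITY, the (46)-TYPE kernel
  `hH`, (55), the fixed-point identity (49), smallness): `‖D A − D A′‖_pin ≤ (16C₂m₀e^{δr₀}·r)·(m·K₁ d (δ−δ′))·‖A −
  A′‖_pin` on the flat ball, for `0 ≤ δ′ < δ < δ_H` — the `D` letter of S70's `Z_V` in the two-norm chain, VOLUME-FREE.
NOT HERE (said): the pinned fixed point `solAt` and the END (S70 f2∕f3, leaf-01-g6); `H`, `H₁`, `𝒢` pinned (S69 (A) on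
their displayed kernels, S70 f1); the identification of `D`, `pos`, `B₀` with Bałaban's objects ([dict]).  No estimate
of Bałaban's at a live level is discharged; NOTHING in the countdown moves.
-/

noncomputable section

open Metric Set Filter Finset
open scoped Topology

namespace Summit.QuantumFields.BalabanUV.T4Continuum.ShellMeasureLandauDerivativeDecayPinned

open Literature.MathematicalPhysics.QuantumFieldTheory.Balaban1983to89
open B12Decay510Window (K₁ K₁_nonneg)
open TreeLengthTorus (TPt)
open B12Decay510Torus (pl1 pl1_nonneg pl1_sub_comm pl1_sub_triangle)
open ShellMeasureMultiGridNorms (WSup)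
open ShellMeasurePinnedNorm (pinW kerOpPin kerOpPin_apply opNorm_kerOpPin_le pinDist pinDist_le_add pinDist_nonneg)
open ShellMeasureDecayKernelSums (kerOp kerOp_apply sum_exp_pl1_comp_le)
open ShellMeasureLandauDerivativeDecay (entry entry_apply)
open ShellMeasureLandauDerivativeDecaySq (kerOp_entry)
open ShellMeasureLandauDerivativeDecayTorus (entry_fderiv_decay_torus)

variable {Λ : Type*} [Fintype Λ] [DecidableEq Λ] {𝔄 : Type*} [NormedAddCommGroup 𝔄] [NormedSpace ℂ 𝔄]

/-! ## §1 A map on bond fields read in pinned coordinates: derivative and the convexity of the flat ball -/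

section Generic

variable {S : Type*} (ρ : S → S → ℝ) (pos : Λ → S) (ϖ : S → ℝ) (δ' : ℝ)

/-- **CHAIN RULE THROUGH THE IDENTITY.**  If `D` has flat derivative `𝔇` at `toPiL Y`, then `Y ↦ toPiL⁻¹(D(toPiL Y))`
has derivative `kerOpPin (entry 𝔇) δ′ (ϖ∘pos) (ϖ∘pos)` at `Y` in the pinned space — S69's conjugated kernel operator of
the (64) kernel of `𝔇` (`kerOp (entry 𝔇) = 𝔇`). [folklore] -/
theorem hasFDerivAt_pinned {D : (Λ → 𝔄) → (Λ → 𝔄)} {Y : WSup (pinW δ' (ϖ ∘ pos)) 1 𝔄}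
    {𝔇 : (Λ → 𝔄) →L[ℂ] (Λ → 𝔄)} (hD : HasFDerivAt D 𝔇 (WSup.toPiL (pinW δ' (ϖ ∘ pos)) 1 Y)) :
    HasFDerivAt
      (fun Y : WSup (pinW δ' (ϖ ∘ pos)) 1 𝔄 =>
        ((WSup.toPiL (pinW δ' (ϖ ∘ pos)) 1).symm (D (WSup.toPiL (pinW δ' (ϖ ∘ pos)) 1 Y)) :
          WSup (pinW δ' (ϖ ∘ pos)) 1 𝔄))
      (kerOpPin (entry 𝔇) δ' (ϖ ∘ pos) (ϖ ∘ pos)) Y := by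
  have h := ((WSup.toPiL (𝔄 := 𝔄) (pinW δ' (ϖ ∘ pos)) 1).symm.hasFDerivAt).comp Y
    (hD.comp Y ((WSup.toPiL (𝔄 := 𝔄) (pinW δ' (ϖ ∘ pos)) 1).hasFDerivAt))
  have hk : kerOpPin (entry 𝔇) δ' (ϖ ∘ pos) (ϖ ∘ pos) =
      ((WSup.toPiL (𝔄 := 𝔄) (pinW δ' (ϖ ∘ pos)) 1).symm : (Λ → 𝔄) →L[ℂ] WSup (pinW δ' (ϖ ∘ pos)) 1 𝔄).comp
        (𝔇.comp ((WSup.toPiL (𝔄 := 𝔄) (pinW δ' (ϖ ∘ pos)) 1) : WSup (pinW δ' (ϖ ∘ pos)) 1 𝔄 →L[ℂ] (Λ → 𝔄))) := by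
    unfold kerOpPin
    rw [kerOp_entry]
  rw [hk]
  exact h

omit [DecidableEq Λ] in
/-- The flat ball `{Y : toPiL Y ∈ ball 0 r}` is CONVEX in the pinned space (preimage of a convex set under the ℝ-linear
identity). [folklore] -/
theorem convex_preimage_ball (r : ℝ) :
    Convex ℝ {Y : WSup (pinW δ' (ϖ ∘ pos)) 1 𝔄 | WSup.toPiL (pinW δ' (ϖ ∘ pos)) 1 Y ∈ ball (0 : Λ → 𝔄) r} := by
  intro Y hY Y' hY' a b ha hb hab
  simp only [mem_setOf_eq, mem_ball_zero_iff] at hY hY' ⊢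
  have hlin : WSup.toPiL (pinW δ' (ϖ ∘ pos)) 1 (a • Y + b • Y') =
      (a : ℂ) • WSup.toPiL (pinW δ' (ϖ ∘ pos)) 1 Y + (b : ℂ) • WSup.toPiL (pinW δ' (ϖ ∘ pos)) 1 Y' := by
    rw [← Complex.coe_smul a Y, ← Complex.coe_smul b Y', map_add, map_smul, map_smul]
  rw [hlin]
  rcases ha.eq_or_lt with rfl | ha'
  · simp only [Complex.ofReal_zero, zero_smul, zero_add] at hab ⊢
    rw [hab, Complex.ofReal_one, one_smul]; exact hY'
  calc ‖(a : ℂ) • WSup.toPiL (pinW δ' (ϖ ∘ pos)) 1 Y + (b : ℂ) • WSup.toPiL (pinW δ' (ϖ ∘ pos)) 1 Y'‖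
      ≤ ‖(a : ℂ) • WSup.toPiL (pinW δ' (ϖ ∘ pos)) 1 Y‖ + ‖(b : ℂ) • WSup.toPiL (pinW δ' (ϖ ∘ pos)) 1 Y'‖ :=
        norm_add_le _ _
    _ = a * ‖WSup.toPiL (pinW δ' (ϖ ∘ pos)) 1 Y‖ + b * ‖WSup.toPiL (pinW δ' (ϖ ∘ pos)) 1 Y'‖ := by
        rw [norm_smul, norm_smul, Complex.norm_real, Complex.norm_real, Real.norm_of_nonneg ha,
          Real.norm_of_nonneg hb]
    _ < a * r + b * r := by
        have h1 : a * ‖WSup.toPiL (pinW δ' (ϖ ∘ pos)) 1 Y‖ < a * r := mul_lt_mul_of_pos_left hY ha'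
        have h2 : b * ‖WSup.toPiL (pinW δ' (ϖ ∘ pos)) 1 Y'‖ ≤ b * r := mul_le_mul_of_nonneg_left hY'.le hb
        linarith
    _ = r := by rw [← add_mul, hab, one_mul]

/-! ## §2 The pinned mean-value bound from a (73)-TYPE derivative-kernel decay -/

/-- **PINNED LIPSCHITZ BOUND FROM A DECAYING DERIVATIVE KERNEL.**  `D` differentiable on the flat ball `ball 0 r` with
`‖entry (DD(A)) c b‖ ≤ κ·e^{−δρ(pos c, pos b)}` there ((73) TYPE, `κ ≥ 0`); pin profile one-sided Lipschitz
(`ϖ x ≤ ϖ y + ρ x y`), `0 ≤ δ′`, reduced-rate sums `Σ_b e^{−(δ−δ′)ρ(x, pos b)} ≤ M`.  Then for all `A, A′` in the flat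
ball: `‖D A − D A′‖_pin ≤ κ·M·‖A − A′‖_pin` (fields read in `WSup (pinW δ′ (ϖ∘pos)) 1` through `toPiL⁻¹`). [folklore] -/
theorem norm_sub_pin_le_of_entry_decay {D : (Λ → 𝔄) → (Λ → 𝔄)} {r κ δ M : ℝ} (hκ : 0 ≤ κ) (hδ' : 0 ≤ δ')
    (hM0 : 0 ≤ M) (hϖ : ∀ x y, ϖ x ≤ ϖ y + ρ x y)
    (hM : ∀ x : S, ∑ b, Real.exp (-((δ - δ') * ρ x (pos b))) ≤ M)
    (hD : DifferentiableOn ℂ D (ball 0 r))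
    (hdec : ∀ A ∈ ball (0 : Λ → 𝔄) r, ∀ c b,
      ‖entry (fderiv ℂ D A) c b‖ ≤ κ * Real.exp (-(δ * ρ (pos c) (pos b))))
    {A A' : Λ → 𝔄} (hA : A ∈ ball (0 : Λ → 𝔄) r) (hA' : A' ∈ ball (0 : Λ → 𝔄) r) :
    ‖((WSup.toPiL (pinW δ' (ϖ ∘ pos)) 1).symm (D A) -
        (WSup.toPiL (pinW δ' (ϖ ∘ pos)) 1).symm (D A') : WSup (pinW δ' (ϖ ∘ pos)) 1 𝔄)‖ ≤
      κ * M * ‖((WSup.toPiL (pinW δ' (ϖ ∘ pos)) 1).symm A -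
        (WSup.toPiL (pinW δ' (ϖ ∘ pos)) 1).symm A' : WSup (pinW δ' (ϖ ∘ pos)) 1 𝔄)‖ := by
  set e := WSup.toPiL (𝔄 := 𝔄) (pinW δ' (ϖ ∘ pos)) 1 with he
  set s : Set (WSup (pinW δ' (ϖ ∘ pos)) 1 𝔄) := {Y | e Y ∈ ball (0 : Λ → 𝔄) r} with hs
  have hconv : Convex ℝ s := convex_preimage_ball pos ϖ δ' r
  -- derivative within `s` at every point, and its pinned bound
  have hf : ∀ Y ∈ s, HasFDerivWithinAt (fun Y : WSup (pinW δ' (ϖ ∘ pos)) 1 𝔄 => (e.symm (D (e Y)) : WSup _ 1 𝔄))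
      (kerOpPin (entry (fderiv ℂ D (e Y))) δ' (ϖ ∘ pos) (ϖ ∘ pos)) s Y := fun Y hY =>
    (hasFDerivAt_pinned pos ϖ δ' ((hD.differentiableAt (isOpen_ball.mem_nhds hY)).hasFDerivAt)).hasFDerivWithinAt
  have hbound : ∀ Y ∈ s, ‖kerOpPin (entry (fderiv ℂ D (e Y))) δ' (ϖ ∘ pos) (ϖ ∘ pos)‖ ≤ κ * M := fun Y hY =>
    opNorm_kerOpPin_le (entry (fderiv ℂ D (e Y))) ρ pos pos ϖ hκ hδ' hM0 (hdec (e Y) hY) hϖ hM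
  have hAs : e.symm A ∈ s := by
    show e (e.symm A) ∈ ball (0 : Λ → 𝔄) r
    rw [e.apply_symm_apply]; exact hA
  have hA's : e.symm A' ∈ s := by
    show e (e.symm A') ∈ ball (0 : Λ → 𝔄) r
    rw [e.apply_symm_apply]; exact hA'
  have key := hconv.norm_image_sub_le_of_norm_hasFDerivWithin_le hf hbound hA's hAs
  simpa using key

omit [DecidableEq Λ] in
/-- The VARIATION from the origin: if moreover `D 0 = 0`, then `‖D A‖_pin ≤ κ·M·‖A‖_pin` on the flat ball. [folklore] -/
theorem norm_pin_le_of_norm_sub_pin_le {D : (Λ → 𝔄) → (Λ → 𝔄)} {L : ℝ} (hD0 : D 0 = 0) {A : Λ → 𝔄}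
    (h : ‖((WSup.toPiL (pinW δ' (ϖ ∘ pos)) 1).symm (D A) -
        (WSup.toPiL (pinW δ' (ϖ ∘ pos)) 1).symm (D 0) : WSup (pinW δ' (ϖ ∘ pos)) 1 𝔄)‖ ≤
      L * ‖((WSup.toPiL (pinW δ' (ϖ ∘ pos)) 1).symm A -
        (WSup.toPiL (pinW δ' (ϖ ∘ pos)) 1).symm 0 : WSup (pinW δ' (ϖ ∘ pos)) 1 𝔄)‖) :
    ‖((WSup.toPiL (pinW δ' (ϖ ∘ pos)) 1).symm (D A) : WSup (pinW δ' (ϖ ∘ pos)) 1 𝔄)‖ ≤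
      L * ‖((WSup.toPiL (pinW δ' (ϖ ∘ pos)) 1).symm A : WSup (pinW δ' (ϖ ∘ pos)) 1 𝔄)‖ := by
  simpa [hD0] using h

end Generic

/-! ## §3 The instance: the Landau correction of S67 f3 on the torus, pinned to a block -/

section Torus

variable {d T : ℕ} [NeZero T]

/-- **THE LANDAU CORRECTION IS PINNED-LIPSCHITZ, VOLUME-FREE.**  Data of S67 f3 `entry_fderiv_decay_torus` (placement
`pos : Λ → (ℤ∕Tℤ)ᵈ` with ≤ `m` bonds per site; `C` with END-II's∕S64's pair (hCd, hCq) and LOCAL (`loc`, `m₀`, `r₀`);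
`H = kerOp hH`, `‖hH e c‖ ≤ h₀e^{−δ_H·pl1}` — (46) TYPE, displayed; `D` differentiable on the flat `ball 0 r` with the
fixed-point identity (49) and (55); smallness) plus a pin rate `0 ≤ δ′ < δ < δ_H` and the block's site set `B₀`
(nonempty): for all `A, A′ ∈ ball 0 r`,
`‖D A − D A′‖_pin ≤ (16C₂m₀e^{δr₀}·r)·(m·K₁ d (δ − δ′))·‖A − A′‖_pin` in S69's `WSup (pinW δ′ (pinDist B₀ ∘ pos)) 1` —
row S70's (ii)∕(iv) input for the `D` letter of the exponent field, by NAME. [folklore] -/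
theorem norm_sub_pin_le_torus (pos : Λ → TPt d T) {m : ℕ}
    (hm : ∀ x, (Finset.univ.filter fun b => pos b = x).card ≤ m)
    {C D : (Λ → 𝔄) → (Λ → 𝔄)} {R C₂ r : ℝ} (hC₂ : 0 ≤ C₂) (hr : 0 ≤ r)
    (hCd : DifferentiableOn ℂ C (ball 0 R)) (hCq : ∀ Z ∈ ball (0 : Λ → 𝔄) R, ‖C Z‖ ≤ C₂ * ‖Z‖ ^ 2)
    (loc : Λ → Finset Λ) {m₀ : ℕ} {r₀ : ℝ} (hcard : ∀ c, (loc c).card ≤ m₀)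
    (hdist : ∀ c, ∀ b' ∈ loc c, pl1 (pos c - pos b') ≤ r₀)
    (hloc : ∀ c, ∀ Z Z' : Λ → 𝔄, (∀ b ∈ loc c, Z b = Z' b) → C Z c = C Z' c)
    (hH : Λ → Λ → (𝔄 →L[ℂ] 𝔄)) {h₀ δH δ δ' : ℝ} (hh₀ : 0 ≤ h₀) (hδ'0 : 0 ≤ δ') (hδ'δ : δ' < δ) (hδ : δ < δH)
    (hh : ∀ e c, ‖hH e c‖ ≤ h₀ * Real.exp (-(δH * pl1 (pos e - pos c))))
    (hD : DifferentiableOn ℂ D (ball 0 r)) (hfix : ∀ x ∈ ball (0 : Λ → 𝔄) r, D x = C (x - kerOp hH (D x)))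
    (h55 : ∀ A ∈ ball (0 : Λ → 𝔄) r, ‖D A‖ ≤ 4 * C₂ * ‖A‖ ^ 2)
    (hrR : 4 * r ≤ R) (hsmall₁ : 4 * C₂ * (h₀ * (m * K₁ d (δH - δ))) * r ≤ 1)
    (hsmall₂ : 16 * C₂ * m₀ * Real.exp (δ * r₀) * (h₀ * (m * K₁ d (δH - δ))) * r ≤ 1)
    (B₀ : Finset (TPt d T)) (hB₀ : B₀.Nonempty)
    {A A' : Λ → 𝔄} (hA : A ∈ ball (0 : Λ → 𝔄) r) (hA' : A' ∈ ball (0 : Λ → 𝔄) r) :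
    ‖((WSup.toPiL (pinW δ' (pinDist B₀ hB₀ ∘ pos)) 1).symm (D A) -
        (WSup.toPiL (pinW δ' (pinDist B₀ hB₀ ∘ pos)) 1).symm (D A') : WSup (pinW δ' (pinDist B₀ hB₀ ∘ pos)) 1 𝔄)‖ ≤
      (16 * C₂ * m₀ * Real.exp (δ * r₀) * r) * (m * K₁ d (δ - δ')) *
        ‖((WSup.toPiL (pinW δ' (pinDist B₀ hB₀ ∘ pos)) 1).symm A -
          (WSup.toPiL (pinW δ' (pinDist B₀ hB₀ ∘ pos)) 1).symm A' : WSup (pinW δ' (pinDist B₀ hB₀ ∘ pos)) 1 𝔄)‖ := by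
  have hδ0 : 0 ≤ δ := hδ'0.trans hδ'δ.le
  have hdec := entry_fderiv_decay_torus pos hm hC₂ hCd hCq loc hcard hdist hloc hH hh₀ hδ0 hδ hh hD hfix h55 hrR
    hsmall₁ hsmall₂
  refine norm_sub_pin_le_of_entry_decay (fun x y : TPt d T => pl1 (x - y)) pos (pinDist B₀ hB₀) δ'
    (by positivity) hδ'0 (mul_nonneg (Nat.cast_nonneg m) (K₁_nonneg d _)) (pinDist_le_add B₀ hB₀)
    (fun x => sum_exp_pl1_comp_le pos hm (by linarith) x) hD (fun A₁ hA₁ c b => ?_) hA hA'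
  -- on the ball `‖A₁‖ < r`, so the `‖A₁‖`-linear prefactor of S67 f3 is below `… · r`
  have hA₁r : ‖A₁‖ ≤ r := (mem_ball_zero_iff.mp hA₁).le
  calc ‖entry (fderiv ℂ D A₁) c b‖
      ≤ (16 * C₂ * m₀ * Real.exp (δ * r₀)) * ‖A₁‖ * Real.exp (-(δ * pl1 (pos c - pos b))) := hdec A₁ hA₁ c b
    _ ≤ (16 * C₂ * m₀ * Real.exp (δ * r₀)) * r * Real.exp (-(δ * pl1 (pos c - pos b))) := by gcongr

end Torus

end Summit.QuantumFields.BalabanUV.T4Continuum.ShellMeasureLandauDerivativeDecayPinned
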